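import Literature.RingTheory.MvPolynomial.RefinedBezoutIsolatedZeros
import Literature.Computability.AlgebraicComplexity.DeterminantalConormalBoundQuadric
import Mathlib.Analysis.Complex.Polynomial.Basic
import HarnessLib

/-!
# The class inequality `#T_f(a, b, c) ≤ d (d-1)^{N-2}` for finite polar sets, and Sheshadri's
# polar-count bound for `N = 4`

Topic: `Literature/Computability/AlgebraicComplexity`. For a form `f` of degree `d ≥ 2` in
`N ≥ 2` variables over `ℂ`, covectors `a, b` with a non-zero `2 × 2` minor (equivalently,
linearly independent) and any chart covector `c`, **every FINITE polar set
`T_f(a, b, c) = {x : f(x) = 0, ∇f(x) ≠ 0, ∇f(x) ∈ ℂa + ℂb, c·x = 1}`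
(`Literature.Computability.AlgebraicComplexity.polarSet`) has at most `d (d-1)^{N-2}` points**
(`ncard_polarSet_le_mul_pow_fin`, `ncard_polarSet_le_mul_pow`). This is the classical upper
bound of the class of a hypersurface of degree `d` in `ℙ^{N-1}` by its value `d(d-1)^{N-2}` for
smooth hypersurfaces (Plücker–Teissier), in the elementary polar-count form used by the
`ValiantsHypothesis` routes — with no smoothness, reducedness, genericity or determinantal
hypothesis: the points of a finite polar set are isolated points of the projective zero set of
`f` and of the `N` forms `δ ∂_i f - s(∇f) a_i - t(∇f) b_i` of degree `d - 1` expressing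
`rank (∇f, a, b) ≤ 2` through the non-zero minor `δ = a_{j₀} b_{k₀} - a_{k₀} b_{j₀}`
(`polarSystem_eq_zero_iff`), so the refined Bézout count of isolated zeros
(`Literature.RingTheory.MvPolynomial.card_le_mul_pow_of_isolated`, Fulton Ex. 8.4.6 / 12.3.1)
applies with degrees `d; d-1, …, d-1`.

Consequences for the named fact `Sheshadri2026_polarCount_le` (arXiv:2606.13628 Thm. 3 (i) in
polar-count form): it holds whenever `d'(d'-1)^{N-2} ≤ B(m, N)` for all `2 ≤ d' ≤ m`
(`Sheshadri2026_polarCount_le_of_mul_pow_le`; genericity polynomial `Φ = a_{i₀}b_{i₁} - a_{i₁}b_{i₀}`,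
an infinite polar set having `ncard = 0`), in particular **for `N = |σ| = 4` and every `m`**
(`Sheshadri2026_polarCount_le_of_card_eq_four`: `d(d-1)² ≤ m(m-1)² = C(m,2)·C(m-1,1)·C(2,1)`, the
middle term of `B(m, 4)`), collected with the earlier cases in
`Sheshadri2026_polarCount_le_of_card_le_four` (`|σ| ≤ 4 ∨ deg f ≤ 2 ∨ m ≤ 2 ∨ 2m < |σ|`). The route
shape (`PermanentClass.KernelIncidenceBound`: all pencils with `a, b` linearly independent and a
finite genuine polar set) is served by `ncard_genuinePolarSet_le_mul_pow` with the classical bound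
`d(d-1)^{N-2}` and, for `3 ≤ |σ| ≤ 4`, verbatim with Sheshadri's bound
(`ncard_polarSet_le_conormalBezout_of_card_le_four`,
`ncard_genuinePolarSet_le_sum_range_of_card_le_four`).

## References

* W. Fulton, *Intersection Theory*, 2nd ed., Springer 1998, Example 8.4.6, Example 12.3.1
  (refined Bézout). [Fulton1998]
* K. Sheshadri, arXiv:2606.13628 (2026), Thm. 3 (i), Remark 3. [Sheshadri2026Border] —
  unrefereed claim.
-/

noncomputable section

open MvPolynomial

namespace Literature.Computability.AlgebraicComplexity

namespace DeterminantalConormal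

/-! ### Linear algebra of the pencil condition -/

/-- Linearly independent `a, b` have a non-zero `2 × 2` minor. [folklore] -/
theorem exists_minor_ne_zero_of_linearIndependent {σ : Type*} {a b : σ → ℂ}
    (hab : LinearIndependent ℂ ![a, b]) : ∃ j k, a j * b k - a k * b j ≠ 0 := by
  by_contra h
  push Not at h
  have ha : a ≠ 0 := hab.ne_zero 0
  obtain ⟨j, hj⟩ : ∃ j, a j ≠ 0 := by
    by_contra h'
    push Not at h'
    exact ha (funext h')
  have hrel : (b j) • a + (-a j) • b = 0 := by
    funext k
    simp only [Pi.add_apply, Pi.smul_apply, smul_eq_mul, Pi.zero_apply]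
    linear_combination (-1 : ℂ) * h j k
  exact hj (neg_eq_zero.mp (hab.eq_zero_of_pair hrel).2)

/-- **The polar system.** For covectors `a, b` and indices `j₀, k₀` put
`δ = a_{j₀} b_{k₀} - a_{k₀} b_{j₀}`; for a vector `w` (think `w = ∇f(x)`) the quantities
`δ w_i - (b_{k₀} w_{j₀} - b_{j₀} w_{k₀}) a_i - (a_{j₀} w_{k₀} - a_{k₀} w_{j₀}) b_i` all vanish iff
`w ∈ ℂa + ℂb`, provided `δ ≠ 0` (Cramer's rule in the coordinates `j₀, k₀`). [folklore] -/
theorem polarSystem_eq_zero_iff {σ : Type*} {a b w : σ → ℂ} {j₀ k₀ : σ}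
    (hδ : a j₀ * b k₀ - a k₀ * b j₀ ≠ 0) :
    (∀ i, (a j₀ * b k₀ - a k₀ * b j₀) * w i - (b k₀ * w j₀ - b j₀ * w k₀) * a i -
        (a j₀ * w k₀ - a k₀ * w j₀) * b i = 0) ↔
      ∃ s t : ℂ, ∀ i, w i = s * a i + t * b i := by
  constructor
  · intro h
    refine ⟨(b k₀ * w j₀ - b j₀ * w k₀) / (a j₀ * b k₀ - a k₀ * b j₀),
      (a j₀ * w k₀ - a k₀ * w j₀) / (a j₀ * b k₀ - a k₀ * b j₀), fun i => ?_⟩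
    rw [eq_comm, div_mul_eq_mul_div, div_mul_eq_mul_div, ← add_div, div_eq_iff hδ]
    linear_combination (-1 : ℂ) * h i
  · rintro ⟨s, t, hw⟩ i
    rw [hw i, hw j₀, hw k₀]
    ring

/-! ### The class inequality for forms in `N` variables -/

/-- **Class inequality, `Fin N` version**: for a form `f` of degree `d ≥ 2` in `N ≥ 2` variables
over `ℂ`, covectors `a, b` with a non-zero `2 × 2` minor and any `c`, a FINITE polar set
`T_f(a, b, c)` has at most `d (d-1)^{N-2}` points — the isolated zeros of
`f, δ ∂_i f - s(∇f) a_i - t(∇f) b_i` (degrees `d; d-1, …, d-1`) counted by refined Bézout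
(Fulton, *Intersection Theory*, Ex. 8.4.6 / 12.3.1). [cite: Fulton1998, Example 12.3.1] -/
theorem ncard_polarSet_le_mul_pow_fin {N : ℕ} (hN : 2 ≤ N) {f : MvPolynomial (Fin N) ℂ} {d : ℕ}
    (hf : f.IsHomogeneous d) (hd : 2 ≤ d) {a b : Fin N → ℂ} (c : Fin N → ℂ)
    (hab : ∃ j k, a j * b k - a k * b j ≠ 0) (hfin : (polarSet f a b c).Finite) :
    (polarSet f a b c).ncard ≤ d * (d - 1) ^ (N - 2) := by
  classical
  by_cases hf0 : f = 0
  · rw [hf0, polarSet_zero, Set.ncard_empty]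
    exact Nat.zero_le _
  obtain ⟨j₀, k₀, hδ⟩ := hab
  -- the polar system `q_i`
  set q : Fin N → MvPolynomial (Fin N) ℂ := fun i =>
    C (a j₀ * b k₀ - a k₀ * b j₀) * pderiv i f -
      (C (b k₀) * pderiv j₀ f - C (b j₀) * pderiv k₀ f) * C (a i) -
      (C (a j₀) * pderiv k₀ f - C (a k₀) * pderiv j₀ f) * C (b i) with hqdef
  have hqeval : ∀ (y : Fin N → ℂ) (i : Fin N), eval y (q i) =
      (a j₀ * b k₀ - a k₀ * b j₀) * eval y (pderiv i f) -
        (b k₀ * eval y (pderiv j₀ f) - b j₀ * eval y (pderiv k₀ f)) * a i -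
        (a j₀ * eval y (pderiv k₀ f) - a k₀ * eval y (pderiv j₀ f)) * b i := by
    intro y i
    simp only [hqdef, map_sub, map_mul, eval_C]
  have hqiff : ∀ y : Fin N → ℂ, (∀ i, eval y (q i) = 0) ↔
      ∃ s t : ℂ, ∀ i, eval y (pderiv i f) = s * a i + t * b i := by
    intro y
    simp only [hqeval]
    exact polarSystem_eq_zero_iff hδ
  have hp : ∀ j, (pderiv j f).IsHomogeneous (d - 1) := fun j => hf.pderiv
  have hmulC : ∀ (φ : MvPolynomial (Fin N) ℂ), φ.IsHomogeneous (d - 1) → ∀ r : ℂ,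
      (φ * C r).IsHomogeneous (d - 1) := by
    intro φ hφ r
    have h := hφ.mul (isHomogeneous_C (Fin N) r)
    rwa [add_zero] at h
  have hqhom : ∀ i, (q i).IsHomogeneous (d - 1) := fun i =>
    (((hp i).C_mul _).sub (hmulC _ (((hp j₀).C_mul _).sub ((hp k₀).C_mul _)) _)).sub
      (hmulC _ (((hp k₀).C_mul _).sub ((hp j₀).C_mul _)) _)
  -- membership in the polar set, unfolded once
  have hmem : ∀ x, x ∈ polarSet f a b c ↔ eval x f = 0 ∧ (∃ i, eval x (pderiv i f) ≠ 0) ∧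
      (∃ s t : ℂ, ∀ i, eval x (pderiv i f) = s * a i + t * b i) ∧ ∑ i, c i * x i = 1 :=
    fun x => Iff.rfl
  -- scaling of `f`, `∂f` and the chart along a line
  have hfsc : ∀ (t : ℂ) (y : Fin N → ℂ), eval (t • y) f = t ^ d * eval y f := fun t y =>
    Literature.RingTheory.MvPolynomial.eval_smul_of_isHomogeneous hf t y
  have hpsc : ∀ (t : ℂ) (y : Fin N → ℂ) (i : Fin N),
      eval (t • y) (pderiv i f) = t ^ (d - 1) * eval y (pderiv i f) := fun t y i =>
    Literature.RingTheory.MvPolynomial.eval_smul_of_isHomogeneous (hp i) t y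
  have hcsc : ∀ (t : ℂ) (y : Fin N → ℂ), ∑ i, c i * (t • y) i = t * ∑ i, c i * y i := by
    intro t y
    rw [Finset.mul_sum]
    refine Finset.sum_congr rfl fun i _ => ?_
    rw [Pi.smul_apply, smul_eq_mul]
    ring
  -- the count
  set T : Finset (Fin N → ℂ) := hfin.toFinset with hTdef
  have hTmem : ∀ x, x ∈ T ↔ x ∈ polarSet f a b c := fun x => by
    rw [hTdef, Set.Finite.mem_toFinset]
  rw [Set.ncard_eq_toFinset_card _ hfin]
  refine Literature.RingTheory.MvPolynomial.card_le_mul_pow_of_isolated (K := ℂ) (B := Set.range q)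
    (by omega) (by omega) hN hf0 hf ?_ T ?_ ?_ ?_ ?_ ?_
  · rintro _ ⟨i, rfl⟩
    exact ⟨d - 1, le_rfl, hqhom i⟩
  · -- points of the chart are non-zero
    intro x hx h0
    have h1 := ((hmem x).mp ((hTmem x).mp hx)).2.2.2
    rw [h0] at h1
    simp at h1
  · -- the chart picks one point on each line
    intro x hx x' hx' t ht
    have h1 := ((hmem x).mp ((hTmem x).mp hx)).2.2.2
    have h1' := ((hmem x').mp ((hTmem x').mp hx')).2.2.2
    rw [ht, hcsc, h1, mul_one] at h1'
    rw [ht, h1', one_smul]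
  · intro x hx
    exact ((hmem x).mp ((hTmem x).mp hx)).1
  · rintro x hx _ ⟨i, rfl⟩
    exact ((hqiff x).mpr ((hmem x).mp ((hTmem x).mp hx)).2.2.1) i
  · -- isolation: `F = (c·X) ∂_{i₀} f`
    intro x hx
    obtain ⟨hfx, ⟨i₀, hi₀⟩, hspan, hchart⟩ := (hmem x).mp ((hTmem x).mp hx)
    refine ⟨(∑ i, C (c i) * X i) * pderiv i₀ f, ?_, ?_⟩
    · have hev : eval x (∑ i, C (c i) * X i) = ∑ i, c i * x i := by
        simp [map_sum]
      rw [map_mul, hev, hchart, one_mul]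
      exact hi₀
    · intro y hyf hyq hyF
      have hev : eval y (∑ i, C (c i) * X i) = ∑ i, c i * y i := by
        simp [map_sum]
      rw [map_mul, hev] at hyF
      have hlam : ∑ i, c i * y i ≠ 0 := left_ne_zero_of_mul hyF
      have hy₀ : eval y (pderiv i₀ f) ≠ 0 := right_ne_zero_of_mul hyF
      set lam : ℂ := ∑ i, c i * y i with hlamdef
      have hyq' : ∀ i, eval y (q i) = 0 := fun i => hyq (q i) ⟨i, rfl⟩
      obtain ⟨s, t, hst⟩ := (hqiff y).mp hyq'
      refine ⟨lam⁻¹ • y, (hTmem _).mpr ((hmem _).mpr ⟨?_, ⟨i₀, ?_⟩, ?_, ?_⟩), lam, ?_⟩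
      · rw [hfsc, hyf, mul_zero]
      · rw [hpsc]
        exact mul_ne_zero (pow_ne_zero _ (inv_ne_zero hlam)) hy₀
      · refine ⟨(lam⁻¹) ^ (d - 1) * s, (lam⁻¹) ^ (d - 1) * t, fun i => ?_⟩
        rw [hpsc, hst i]
        ring
      · rw [hcsc, ← hlamdef, inv_mul_cancel₀ hlam]
      · rw [smul_smul, mul_inv_cancel₀ hlam, one_smul]

/-- **Class inequality** (any finite index type): for a form `f ∈ ℂ[x_σ]` of degree `d ≥ 2`,
`|σ| ≥ 2`, covectors `a, b` with a non-zero `2 × 2` minor and any `c`, a finite polar set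
`T_f(a, b, c)` has at most `d (d-1)^{|σ|-2}` points. [cite: Fulton1998, Example 12.3.1] -/
theorem ncard_polarSet_le_mul_pow {σ : Type*} [Fintype σ] (hσ : 2 ≤ Fintype.card σ)
    {f : MvPolynomial σ ℂ} {d : ℕ} (hf : f.IsHomogeneous d) (hd : 2 ≤ d) {a b : σ → ℂ}
    (c : σ → ℂ) (hab : ∃ j k, a j * b k - a k * b j ≠ 0) (hfin : (polarSet f a b c).Finite) :
    (polarSet f a b c).ncard ≤ d * (d - 1) ^ (Fintype.card σ - 2) := by
  classical
  set e : σ ≃ Fin (Fintype.card σ) := Fintype.equivFin σ with he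
  rw [← ncard_polarSet_rename e f a b c]
  refine ncard_polarSet_le_mul_pow_fin hσ (hf.rename_isHomogeneous (f := e)) hd (c ∘ e.symm) ?_ ?_
  · obtain ⟨j, k, hjk⟩ := hab
    exact ⟨e j, e k, by simpa using hjk⟩
  · refine (hfin.image fun x : σ → ℂ => x ∘ e.symm).subset ?_
    intro y hy
    refine ⟨y ∘ e, (comp_mem_polarSet_rename_iff e f a b c (y ∘ e)).mp ?_, ?_⟩
    · convert hy using 2
      funext j
      simp
    · funext j
      simp

/-- **Class inequality for linearly independent `a, b`**: `#T_f(a,b,c) ≤ d(d-1)^{|σ|-2}` for every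
finite polar set of a form of degree `d ≥ 2` in `|σ| ≥ 2` variables.
[cite: Fulton1998, Example 12.3.1] -/
theorem ncard_polarSet_le_mul_pow_of_linearIndependent {σ : Type*} [Fintype σ]
    (hσ : 2 ≤ Fintype.card σ) {f : MvPolynomial σ ℂ} {d : ℕ} (hf : f.IsHomogeneous d)
    (hd : 2 ≤ d) {a b : σ → ℂ} (c : σ → ℂ) (hab : LinearIndependent ℂ ![a, b])
    (hfin : (polarSet f a b c).Finite) :
    (polarSet f a b c).ncard ≤ d * (d - 1) ^ (Fintype.card σ - 2) :=
  ncard_polarSet_le_mul_pow hσ hf hd c (exists_minor_ne_zero_of_linearIndependent hab) hfin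

/-- **The route shape** (`PermanentClass.KernelIncidenceBound` with the classical bound): for a
form `f` of degree `d ≥ 2` in `|σ| ≥ 2` variables, `a, b` linearly independent and a FINITE genuine
polar set `T = {x : f(x) = 0, Σ cᵢxᵢ = 1, ∇f(x) ≠ 0, ∇f(x) ∈ ℂa + ℂb}`, `#T ≤ d(d-1)^{|σ|-2}`.
[cite: Fulton1998, Example 12.3.1] -/
theorem ncard_genuinePolarSet_le_mul_pow {σ : Type*} [Fintype σ] (hσ : 2 ≤ Fintype.card σ)
    (f : MvPolynomial σ ℂ) (d : ℕ) (hf : f.IsHomogeneous d) (hd : 2 ≤ d) (a b c : σ → ℂ)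
    (hab : LinearIndependent ℂ ![a, b])
    (hfin : {x : σ → ℂ | eval x f = 0 ∧ ∑ i, c i * x i = 1 ∧ (∃ i, eval x (pderiv i f) ≠ 0) ∧
      ∃ p : ℂ × ℂ, ∀ i, eval x (pderiv i f) = p.1 * a i + p.2 * b i}.Finite) :
    {x : σ → ℂ | eval x f = 0 ∧ ∑ i, c i * x i = 1 ∧ (∃ i, eval x (pderiv i f) ≠ 0) ∧
      ∃ p : ℂ × ℂ, ∀ i, eval x (pderiv i f) = p.1 * a i + p.2 * b i}.ncard ≤
      d * (d - 1) ^ (Fintype.card σ - 2) := by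
  have hset : {x : σ → ℂ | eval x f = 0 ∧ ∑ i, c i * x i = 1 ∧ (∃ i, eval x (pderiv i f) ≠ 0) ∧
      ∃ p : ℂ × ℂ, ∀ i, eval x (pderiv i f) = p.1 * a i + p.2 * b i} = polarSet f a b c := by
    ext x
    simp only [Set.mem_setOf_eq, mem_polarSet, Prod.exists]
    tauto
  rw [hset] at hfin ⊢
  exact ncard_polarSet_le_mul_pow_of_linearIndependent hσ hf hd c hab hfin

/-! ### Consequences for Sheshadri's polar-count bound -/

/-- **`m (m-1)² ≤ B(m, 4)`**: the middle term `C(m,2) · C(m-1,1) · C(2,1)` of `B(m, 4)` is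
`m(m-1)²`. [folklore] -/
theorem mul_sq_le_conormalBezout_four (m : ℕ) : m * (m - 1) ^ 2 ≤ conormalBezout m 4 := by
  rw [conormalBezout]
  have heven : m * (m - 1) / 2 * 2 = m * (m - 1) :=
    Nat.div_mul_cancel ((Nat.even_mul_pred_self m).two_dvd)
  have key : m.choose 2 * (m - 1).choose (4 - 1 - 2) * (4 - 2).choose (2 - 1) = m * (m - 1) ^ 2 := by
    rw [show 4 - 1 - 2 = 1 by norm_num, show 4 - 2 = 2 by norm_num,
      Nat.choose_one_right, Nat.choose_one_right, Nat.choose_two_right, mul_assoc,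
      mul_comm (m - 1) 2, ← mul_assoc, heven]
    ring
  rw [← key]
  exact Finset.single_le_sum (f := fun i => m.choose i * (m - 1).choose (4 - 1 - i) *
    (4 - 2).choose (i - 1)) (fun i _ => Nat.zero_le _)
    (Finset.mem_Icc.mpr ⟨by norm_num, by norm_num⟩ : 2 ∈ Finset.Icc 1 (4 - 1))

/-- **Sheshadri's polar-count bound whenever `d'(d'-1)^{N-2} ≤ B(m, N)` for `2 ≤ d' ≤ m`**
(from the class inequality; the determinantal representation is used only through `deg f ≤ m`,
`totalDegree_le_of_hasDetRepr_holds`; forms of degree `≤ 2` are the case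
`Sheshadri2026_polarCount_le_of_totalDegree_le_two`). The genericity polynomial is the minor
`Φ = a_{i₀} b_{i₁} - a_{i₁} b_{i₀}`; an infinite polar set has `ncard = 0`.
[cite: Fulton1998, Example 12.3.1] -/
theorem Sheshadri2026_polarCount_le_of_mul_pow_le {σ : Type} [Fintype σ] [DecidableEq σ]
    (hσ : 3 ≤ Fintype.card σ) (f : MvPolynomial σ ℂ) (d m : ℕ) (hf : f.IsHomogeneous d)
    (hm : HasDetRepr f m)
    (hB : ∀ d', 2 ≤ d' → d' ≤ m →
      d' * (d' - 1) ^ (Fintype.card σ - 2) ≤ conormalBezout m (Fintype.card σ)) :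
    ∃ Φ : MvPolynomial (Fin 3 × σ) ℂ, Φ ≠ 0 ∧ ∀ u : Fin 3 × σ → ℂ, eval u Φ ≠ 0 →
      (polarSet f (fun i => u (0, i)) (fun i => u (1, i)) (fun i => u (2, i))).ncard ≤
        conormalBezout m (Fintype.card σ) := by
  classical
  by_cases hdeg : f.totalDegree ≤ 2
  · exact Sheshadri2026_polarCount_le_of_totalDegree_le_two hσ f d m hdeg hf hm
  have hf0 : f ≠ 0 := fun h => hdeg (by rw [h, totalDegree_zero]; exact Nat.zero_le _)
  have hd : f.totalDegree = d := hf.totalDegree hf0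
  have hd3 : 3 ≤ d := by omega
  have hdm : d ≤ m := hd ▸ totalDegree_le_of_hasDetRepr_holds hm
  -- two distinct indices and the minor `Φ`
  have hcard : 1 < Fintype.card σ := by omega
  obtain ⟨i₀, i₁, hne⟩ := Fintype.exists_pair_of_one_lt_card hcard
  refine ⟨X (0, i₀) * X (1, i₁) - X (0, i₁) * X (1, i₀), ?_, fun u hu => ?_⟩
  · intro h
    have h1 := congr_arg
      (eval (fun p : Fin 3 × σ => if p = (0, i₀) ∨ p = (1, i₁) then (1 : ℂ) else 0)) h
    simp [eval_X, hne, hne.symm] at h1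
  · have hmin : ∃ j k, u (0, j) * u (1, k) - u (0, k) * u (1, j) ≠ 0 := by
      refine ⟨i₀, i₁, ?_⟩
      simpa [map_sub, map_mul, eval_X] using hu
    by_cases hfin : (polarSet f (fun i => u (0, i)) (fun i => u (1, i)) (fun i => u (2, i))).Finite
    · exact (ncard_polarSet_le_mul_pow (by omega) hf (by omega) _ hmin hfin).trans (hB d (by omega) hdm)
    · rw [Set.Infinite.ncard hfin]
      exact Nat.zero_le _

/-! ### All pencils, `|σ| ≤ 4`: the route shape with Sheshadri's bound -/

/-- `m (m-1) ≤ B(m, 3) = 3·C(m, 2)`. [folklore] -/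
theorem mul_pred_le_conormalBezout_three (m : ℕ) : m * (m - 1) ≤ conormalBezout m 3 := by
  rw [conormalBezout_three, Nat.choose_two_right]
  have heven : m * (m - 1) / 2 * 2 = m * (m - 1) :=
    Nat.div_mul_cancel ((Nat.even_mul_pred_self m).two_dvd)
  omega

/-- The polar set of a constant is empty (its gradient vanishes). [folklore] -/
theorem polarSet_eq_empty_of_isHomogeneous_zero {σ : Type*} [Fintype σ] {f : MvPolynomial σ ℂ}
    (hf : f.IsHomogeneous 0) (a b c : σ → ℂ) : polarSet f a b c = ∅ := by
  ext x
  refine ⟨fun hx => ?_, fun hx => (Set.notMem_empty x hx).elim⟩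
  obtain ⟨-, ⟨i, hi⟩, -, -⟩ := hx
  rw [eq_C_of_isHomogeneous_zero hf, pderiv_C, map_zero] at hi
  exact hi rfl

/-- **Sheshadri's bound for ALL pencils when `3 ≤ |σ| ≤ 4`**: for `f ∈ ℂ[x_σ]` homogeneous with
`HasDetRepr f m`, `a, b` linearly independent and a FINITE polar set,
`#T_f(a, b, c) ≤ B(m, |σ|)` — degree `≤ 1`: empty/infinite; quadrics: `≤ 2 ≤ B`; degree
`d ≥ 3`: class inequality `d(d-1)^{|σ|-2} ≤ m(m-1)^{|σ|-2} ≤ B(m, |σ|)`. This is the shape of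
route item `PermanentClass.KernelIncidenceBound` restricted to `|σ| ≤ 4`.
[cite: Fulton1998, Example 12.3.1] -/
theorem ncard_polarSet_le_conormalBezout_of_card_le_four {σ : Type*} [Fintype σ]
    (hσ3 : 3 ≤ Fintype.card σ) (hσ4 : Fintype.card σ ≤ 4) {f : MvPolynomial σ ℂ} {d m : ℕ}
    (hf : f.IsHomogeneous d) (hm : HasDetRepr f m) {a b : σ → ℂ} (c : σ → ℂ)
    (hab : LinearIndependent ℂ ![a, b]) (hfin : (polarSet f a b c).Finite) :
    (polarSet f a b c).ncard ≤ conormalBezout m (Fintype.card σ) := by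
  classical
  by_cases hf0 : f = 0
  · rw [hf0, polarSet_zero, Set.ncard_empty]
    exact Nat.zero_le _
  have hd : f.totalDegree = d := hf.totalDegree hf0
  have hdm : d ≤ m := hd ▸ totalDegree_le_of_hasDetRepr_holds hm
  rcases Nat.lt_or_ge d 3 with hd3 | hd3
  · interval_cases d
    · rw [polarSet_eq_empty_of_isHomogeneous_zero hf, Set.ncard_empty]
      exact Nat.zero_le _
    · rw [ncard_polarSet_eq_zero_of_isHomogeneous_one hσ3 hf]
      exact Nat.zero_le _
    · exact (ncard_polarSet_le_two_of_isHomogeneous_two hf a b c).trans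
        (two_le_conormalBezout hdm hσ3 (by omega))
  · refine (ncard_polarSet_le_mul_pow_of_linearIndependent (by omega) hf (by omega) c hab
      hfin).trans ?_
    have hmono : d * (d - 1) ^ (Fintype.card σ - 2) ≤ m * (m - 1) ^ (Fintype.card σ - 2) :=
      Nat.mul_le_mul hdm (Nat.pow_le_pow_left (Nat.sub_le_sub_right hdm 1) _)
    refine hmono.trans ?_
    rcases (show Fintype.card σ = 3 ∨ Fintype.card σ = 4 by omega) with h3 | h4
    · rw [h3, show 3 - 2 = 1 by norm_num, pow_one]
      exact mul_pred_le_conormalBezout_three m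
    · rw [h4]
      exact mul_sq_le_conormalBezout_four m

/-- **The route shape verbatim for `3 ≤ |σ| ≤ 4`** (`PermanentClass.KernelIncidenceBound` with the
sum spelled over `Finset.range`): for `f` homogeneous of degree `d` with `HasDetRepr f m`, `a, b`
linearly independent and a finite genuine polar set `T`, `#T ≤ Σ_{j < |σ|-1} C(m, j+1) C(m-1,
|σ|-2-j) C(|σ|-2, j)`. [cite: Fulton1998, Example 12.3.1] -/
theorem ncard_genuinePolarSet_le_sum_range_of_card_le_four {σ : Type*} [Fintype σ]
    (hσ3 : 3 ≤ Fintype.card σ) (hσ4 : Fintype.card σ ≤ 4) (f : MvPolynomial σ ℂ) (d m : ℕ)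
    (hf : f.IsHomogeneous d) (hm : HasDetRepr f m) (a b c : σ → ℂ)
    (hab : LinearIndependent ℂ ![a, b])
    (hfin : {x : σ → ℂ | eval x f = 0 ∧ ∑ i, c i * x i = 1 ∧ (∃ i, eval x (pderiv i f) ≠ 0) ∧
      ∃ p : ℂ × ℂ, ∀ i, eval x (pderiv i f) = p.1 * a i + p.2 * b i}.Finite) :
    {x : σ → ℂ | eval x f = 0 ∧ ∑ i, c i * x i = 1 ∧ (∃ i, eval x (pderiv i f) ≠ 0) ∧
      ∃ p : ℂ × ℂ, ∀ i, eval x (pderiv i f) = p.1 * a i + p.2 * b i}.ncard ≤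
      ∑ j ∈ Finset.range (Fintype.card σ - 1),
        m.choose (j + 1) * (m - 1).choose (Fintype.card σ - 2 - j) * (Fintype.card σ - 2).choose j := by
  have hset : {x : σ → ℂ | eval x f = 0 ∧ ∑ i, c i * x i = 1 ∧ (∃ i, eval x (pderiv i f) ≠ 0) ∧
      ∃ p : ℂ × ℂ, ∀ i, eval x (pderiv i f) = p.1 * a i + p.2 * b i} = polarSet f a b c := by
    ext x
    simp only [Set.mem_setOf_eq, mem_polarSet, Prod.exists]
    tauto
  rw [hset] at hfin ⊢
  rw [← conormalBezout_eq_sum_range]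
  exact ncard_polarSet_le_conormalBezout_of_card_le_four hσ3 hσ4 hf hm c hab hfin

end DeterminantalConormal

open DeterminantalConormal in
/-- **Sheshadri's polar-count bound for `N = |σ| = 4`, all `m`** (arXiv:2606.13628 Thm. 3 (i) in
polar-count form, this case PROVED from the classical class inequality
`#T_f ≤ d(d-1)² ≤ m(m-1)² ≤ B(m, 4)`): for `f ∈ ℂ[x_σ]` homogeneous with `HasDetRepr f m` there is
`Φ ≠ 0` with `#T_f(a, b, c) ≤ B(m, 4)` whenever `Φ(a, b, c) ≠ 0`.
[cite: Fulton1998, Example 12.3.1] -/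
theorem Sheshadri2026_polarCount_le_of_card_eq_four {σ : Type} [Fintype σ] [DecidableEq σ]
    (hσ : Fintype.card σ = 4) (f : MvPolynomial σ ℂ) (d m : ℕ) (hf : f.IsHomogeneous d)
    (hm : HasDetRepr f m) :
    ∃ Φ : MvPolynomial (Fin 3 × σ) ℂ, Φ ≠ 0 ∧ ∀ u : Fin 3 × σ → ℂ, eval u Φ ≠ 0 →
      (polarSet f (fun i => u (0, i)) (fun i => u (1, i)) (fun i => u (2, i))).ncard ≤
        conormalBezout m (Fintype.card σ) := by
  refine Sheshadri2026_polarCount_le_of_mul_pow_le (by omega) f d m hf hm fun d' hd' hd'm => ?_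
  rw [hσ]
  calc d' * (d' - 1) ^ (4 - 2) ≤ m * (m - 1) ^ 2 :=
        Nat.mul_le_mul hd'm (Nat.pow_le_pow_left (Nat.sub_le_sub_right hd'm 1) 2)
    _ ≤ conormalBezout m 4 := mul_sq_le_conormalBezout_four m

open DeterminantalConormal in
/-- **The cases of Sheshadri's polar-count bound proved in the tree, collected**: `|σ| ≤ 4`
(`|σ| = 3`: plane Bézout / Plücker, `Sheshadri2026_polarCount_le_of_card_eq_three`; `|σ| = 4`:
the class inequality, `Sheshadri2026_polarCount_le_of_card_eq_four`), or `deg f ≤ 2`, or `m ≤ 2`,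
or `2m < |σ|` (`Sheshadri2026_polarCount_le_of_small_cases`).
[cite: Fulton1998, Example 12.3.1] -/
theorem Sheshadri2026_polarCount_le_of_card_le_four {σ : Type} [Fintype σ] [DecidableEq σ]
    (hσ : 3 ≤ Fintype.card σ) (f : MvPolynomial σ ℂ) (d m : ℕ)
    (hcase : Fintype.card σ ≤ 4 ∨ f.totalDegree ≤ 2 ∨ m ≤ 2 ∨ 2 * m < Fintype.card σ)
    (hf : f.IsHomogeneous d) (hm : HasDetRepr f m) :
    ∃ Φ : MvPolynomial (Fin 3 × σ) ℂ, Φ ≠ 0 ∧ ∀ u : Fin 3 × σ → ℂ, eval u Φ ≠ 0 →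
      (polarSet f (fun i => u (0, i)) (fun i => u (1, i)) (fun i => u (2, i))).ncard ≤
        conormalBezout m (Fintype.card σ) := by
  rcases hcase with h4 | hrest
  · by_cases h3 : Fintype.card σ = 3
    · exact Sheshadri2026_polarCount_le_of_card_eq_three h3 f d m hf hm
    · exact Sheshadri2026_polarCount_le_of_card_eq_four (by omega) f d m hf hm
  · exact Sheshadri2026_polarCount_le_of_small_cases hσ f d m (Or.inr hrest) hf hm

end Literature.Computability.AlgebraicComplexity

end
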